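import Literature.MathematicalPhysics.QuantumFieldTheory.Balaban1983to89.B13BlockBondReadingNumerals
import Literature.MathematicalPhysics.QuantumFieldTheory.Balaban1983to89.B13EntryLetterSockets

/-!
# `Balaban1983to89.B13ReadingTransportY` — T. Bałaban, *Renormalization group approach to lattice gauge field theories. II. Cluster expansions*,
Commun. Math. Phys. **116** (1988) 1–22 [Balaban1988RG2Cluster], (2.5)–(2.7) pp. 12–13 (kernels localized at points of the UNIT torus `T₁^{(k)}` of the
k-th step, decay `e^{−δd(x,x′)}`), p. 15; *Propagators for lattice gauge theories in a background field*, Commun. Math. Phys. **99** (1985) 389–434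
[Balaban1985BackgroundPropagators], (3.3) p. 391, Thm 3.1 (3.42) p. 397 (decay `exp(−δ₀(Lʲη)⁻¹|x − y|)` on the FINE lattice), Thm 3.10 (3.107)–(3.108)
p. 416; *Propagators and renormalization transformations for lattice gauge theories. I*, Commun. Math. Phys. **95** (1984) 17–40
[Balaban1984PropagatorsI], (1.6) p. 18, (1.18) p. 20 (the blocks `B^k(y)` of the torus); *… II*, Commun. Math. Phys. **96** (1984) 223–250
[Balaban1984PropagatorsII], (2.46) p. 231 (the `ℓ¹` lattice distance): THE FINE AND THE UNIT-BLOCK READINGS OF NODE 00's BOX CHART ARE AT BOUNDED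
DISTORTION FROM EACH OTHER, BOTH WAYS — so an entrywise-letters datum read at one of them is read at the other with a located change of rate and
constant (the READING SOCKET of `B13EntryLetterSockets` at the two located readings of `B13SiteReadingNumerals`).

statement-level bookkeeping over the landed `B13SiteReadingNumerals` (dag-n10-w6: `fineReadingY`, `blockReadingY`, `mul_circAbs_ediv_sub_ediv_le`),
`B13BlockBondReadingNumerals` (dag-n10-w4: `bondReadingY`, `blkReadingY`) and `B13EntryLetterSockets` (dag-n10-w3: `rawEntryLetters_of_reading_lipschitz`)
with citation tags; kernel-checked; [folklore] integer rounding and finite sums; nothing here is a claim about the Yang–Mills mass gap; nothing of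
Bałaban's operators is constructed or asserted; no node is discharged; count-neutral.

WHY THIS FILE (cell `pub-ymgap`, HUMAN RULING D-0062, Track A node N10 = [Balaban1988RG2Cluster]; width seat `pub-ymgap-dag-n10-w3` g5).  The N10 lane's
located inverse road concludes its letters data at TWO located readings of NODE 00's box sites `SiteY i` (labels `z ∈ Π_μ[0, N₀_μ)`): the FINE reading
`ℓ_fine z = z` into the site torus with the same periods (rate `< δ₀∕((d+1)L^k)` per fine site: `…_of_reg335_fineReading_record`) and the BLOCK reading
`ℓ_blk z = (⌊z_μ∕L^k⌋)_μ` into the unit torus of the k-th step (rate `< δ₀∕(d+1)` per unit block: `…_of_reg335_blockReading`) — each proved separately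
from Theorem 3.1.  Which reading the N10 term of record uses is NODE 00's ∕ node00-def-T's word (lane census v19∕v20).  THIS FILE records that the
choice costs only located constants: the two readings compare AFFINELY both ways,
`L^k·d₁(ℓ_blk z, ℓ_blk w) ≤ d₁(ℓ_fine z, ℓ_fine w) + (d+1)(L^k − 1)` and `d₁(ℓ_fine z, ℓ_fine w) ≤ L^k·d₁(ℓ_blk z, ℓ_blk w) + (d+1)(L^k − 1)`,
so ANY letters datum (of any family, on any chart, indexed through any map `g` into the sites — bonds by their sources, blocks by their corners)
read at one reading is read at the other: fine `(R, ρ, B)` ⟹ block `(R, ρ·L^k, B·e^{ρ(d+1)(L^k−1)})`; block `(R, ρ, B)` ⟹ fine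
`(R, ρ∕L^k, B·e^{(ρ∕L^k)(d+1)(L^k−1)})` (≤ `B·e^{ρ(d+1)}`).

WHAT THIS FILE PROVES (all `theorem`s; no `def`, no instance, no notation).
§1 [folklore] ★ `circAbs_sub_le_mul_circAbs_ediv` — the converse rounding inequality `dist_{ℤ∕bn}(z,w) ≤ b·dist_{ℤ∕n}(⌊z∕b⌋,⌊w∕b⌋) + (b − 1)` (companion of
   dag-n10-w6's `mul_circAbs_ediv_sub_ediv_le`).
§2 ★ `mul_tdist1_blockReadingY_le` (`L^k·d₁^{blk} ≤ d₁^{fine} + (d+1)(L^k−1)`), ★ `tdist1_fineReadingY_le_mul` (`d₁^{fine} ≤ L^k·d₁^{blk} + (d+1)(L^k−1)`),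
   `tdist1_blockReadingY_le_affine` (the first divided by `L^k`: the `hcmp` shape of `rawEntryLetters_of_reading_lipschitz` with `κ = 1∕L^k`).
§3 ★★ `rawEntryLetters_blockReading_of_fineReading` (any family `Δ : E → Matrix q q ℂ`, any index map `g : q → SiteY i`: letters at `ℓ_fine ∘ g`,
   `ρ ≥ 0` ⟹ letters at `ℓ_blk ∘ g` at `(R, ρ·L^k, B·e^{ρ(d+1)(L^k−1)})`), ★★ `rawEntryLetters_fineReading_of_blockReading` (letters at `ℓ_blk ∘ g`
   ⟹ at `ℓ_fine ∘ g` at `(R, ρ∕L^k, B·e^{(ρ∕L^k)(d+1)(L^k−1)})`), `rawEntryLetters_fineReading_of_blockReading'` (constant `B·e^{ρ(d+1)}`).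
§4 the bond-indexed instances (dag-n10-w4's `bondReadingY = ℓ_fine ∘ chart ∘ src`): `rawEntryLetters_blockBondReading_of_bondReading` ∕
   `rawEntryLetters_bondReading_of_blockBondReading` (index `FBondY i × κ` through `fst`, the block reading of a bond := the unit block of its source).
HONEST FRAMING: [folklore] bookkeeping; the readings and their numerals are dag-n10-w6's ∕ dag-n10-w4's, consumed by name; nothing of Bałaban's asserted;
WHICH reading the N10 term of record uses stays NODE 00's ∕ node00-def-T's word; N10 NOT discharged; no registered stub proved; counts unmoved; one
finite 𝕋⁴ programme at fixed ε — R4 closes the conditional finite-𝕋⁴ rung `BalabanLadder.UV` only; nothing continuum ∕ ℝ⁴ ∕ OS ∕ mass gap ∕ Clay.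
0 `sorry`, 0 `def`, standard axioms.
-/

noncomputable section

namespace Literature.MathematicalPhysics.QuantumFieldTheory.Balaban1983to89.B13ReadingTransportY

open Finset
open scoped Matrix
open Literature.MathematicalPhysics.QuantumFieldTheory.Balaban1983to89
open Node00 B6KLevelCensusIndexV1 B6GlobalChartV1
open Literature.MathematicalPhysics.QuantumFieldTheory.Balaban1983to89.B4TorusKernel.MultiPeriod
open Literature.MathematicalPhysics.QuantumFieldTheory.Balaban1983to89.B5TorusCover (UT)
open Literature.MathematicalPhysics.QuantumFieldTheory.Balaban1983to89.B9Thm37GlueTorus (tdist1 tdist1_nonneg tdist1_comm)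
open Literature.MathematicalPhysics.QuantumFieldTheory.Balaban1983to89.B13EntrywiseWalks (RawEntryLetters)
open Literature.MathematicalPhysics.QuantumFieldTheory.Balaban1983to89.B13EntryLetterAlgebra (rawEntryLetters_mono)
open Literature.MathematicalPhysics.QuantumFieldTheory.Balaban1983to89.B13EntryLetterSockets (rawEntryLetters_of_reading_lipschitz)
open Literature.MathematicalPhysics.QuantumFieldTheory.Balaban1983to89.B13SiteReadingNumerals
open Literature.MathematicalPhysics.QuantumFieldTheory.Balaban1983to89.B13BlockBondReadingNumerals (bondReadingY bondReadingY_apply)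

/-! ## §1. One coordinate: the label distance against the block-label distance -/

/-- ★ **THE CONVERSE ROUNDING INEQUALITY**: `dist_{ℤ∕bn}(z, w) ≤ b·dist_{ℤ∕n}(⌊z∕b⌋, ⌊w∕b⌋) + (b − 1)` — the circular distance of two labels
(period `b·n`) is controlled by the circular distance of their block labels (period `n`) up to the rounding `b − 1` (companion of
`B13SiteReadingNumerals.mul_circAbs_ediv_sub_ediv_le`: centre the block-label difference, lift the centring to the labels).
[cite: Balaban1984PropagatorsI, (1.6) p.18, (1.18) p.20; Balaban1984PropagatorsII, (2.46) p.231] -/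
theorem circAbs_sub_le_mul_circAbs_ediv (b n : ℕ) (hb : 1 ≤ b) (hn : 1 ≤ n) (z w : ℤ) :
    circAbs (b * n) (z - w) ≤ (b : ℤ) * circAbs n (z / b - w / b) + (b - 1) := by
  have hb0 : (0 : ℤ) < b := by exact_mod_cast hb
  set q : ℤ := z / b - w / b with hq
  set m : ℤ := centre n q with hm
  have hc : |q + (n : ℤ) * m| = circAbs n q := abs_add_mul_centre hn q
  have hbn : 1 ≤ b * n := Nat.one_le_iff_ne_zero.2 (Nat.mul_ne_zero_iff.2 ⟨by omega, by omega⟩)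
  have hz : (b : ℤ) * (z / b) + z % b = z := Int.mul_ediv_add_emod z b
  have hw : (b : ℤ) * (w / b) + w % b = w := Int.mul_ediv_add_emod w b
  have key : z - w + ((b * n : ℕ) : ℤ) * m = (b : ℤ) * (q + n * m) + (z % b - w % b) := by
    push_cast; rw [hq]; linear_combination hw - hz
  have hr : |z % (b : ℤ) - w % (b : ℤ)| ≤ (b : ℤ) - 1 := by
    have h0z := Int.emod_nonneg z hb0.ne'
    have h0w := Int.emod_nonneg w hb0.ne'
    have h1z := Int.emod_lt_of_pos z hb0
    have h1w := Int.emod_lt_of_pos w hb0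
    rw [abs_sub_le_iff]; constructor <;> linarith
  calc circAbs (b * n) (z - w) = circAbs (b * n) (z - w + ((b * n : ℕ) : ℤ) * m) := (circAbs_add_mul _ _ _).symm
    _ ≤ |z - w + ((b * n : ℕ) : ℤ) * m| := circAbs_le_abs hbn _
    _ = |(b : ℤ) * (q + n * m) + (z % b - w % b)| := by rw [key]
    _ ≤ |(b : ℤ) * (q + n * m)| + |z % (b : ℤ) - w % (b : ℤ)| := abs_add_le _ _
    _ = (b : ℤ) * circAbs n q + |z % (b : ℤ) - w % (b : ℤ)| := by rw [abs_mul, abs_of_pos hb0, hc]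
    _ ≤ (b : ℤ) * circAbs n q + (b - 1) := by linarith

variable {d ℓ : ℕ} {hd : 1 ≤ d + 1} {hL : Odd (ℓ + 1) ∧ 1 < ℓ + 1} {b₀ b₁ : ℝ}
variable (i : KIdx d ℓ hd hL b₀ b₁)
variable {Nf : Fin (d + 1) → ℕ} [∀ μ, NeZero (Nf μ)] {Nb : Fin (d + 1) → ℕ} [∀ μ, NeZero (Nb μ)]

/-! ## §2. The two readings of NODE 00's box chart compared, both ways -/

section Compare

/-- ★ **BLOCK AGAINST FINE**: `L^k·d₁(ℓ_blk z, ℓ_blk w) ≤ d₁(ℓ_fine z, ℓ_fine w) + (d+1)(L^k − 1)` — dag-n10-w6's `mul_circAbs_ediv_sub_ediv_le` summed over the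
coordinates (fine periods `Nf_μ = N₀_μ`, unit-block periods `Nb_μ`, `N₀_μ = L^k·Nb_μ`).
[cite: Balaban1988RG2Cluster, (2.5) p.12, p.15; Balaban1984PropagatorsII, (2.46) p.231; Balaban1984PropagatorsI, (1.18) p.20] -/
theorem mul_tdist1_blockReadingY_le (hNf : ∀ μ, (toKT i).NB μ = Nf μ) (hNb : ∀ μ, (toKT i).NB μ = (ℓ + 1) ^ i.k * Nb μ) (z w : SiteY i) :
    ((((ℓ + 1) ^ i.k : ℕ) : ℝ)) * tdist1 Nb (blockReadingY i hNb z) (blockReadingY i hNb w) ≤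
      tdist1 Nf (fineReadingY i hNf z) (fineReadingY i hNf w) + ((d : ℝ) + 1) * (((((ℓ + 1) ^ i.k : ℕ) : ℝ)) - 1) := by
  rw [tdist1_blockReadingY_eq, tdist1_fineReadingY_eq, Finset.mul_sum]
  have hb1 : 1 ≤ (ℓ + 1) ^ i.k := Nat.one_le_pow _ _ (Nat.succ_pos ℓ)
  have hcoord : ∀ μ, ((((ℓ + 1) ^ i.k : ℕ) : ℝ)) * ((circAbs (Nb μ) (z.1 μ / (((ℓ + 1) ^ i.k : ℕ) : ℤ) - w.1 μ / (((ℓ + 1) ^ i.k : ℕ) : ℤ)) : ℤ) : ℝ) ≤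
      ((circAbs (Nf μ) (z.1 μ - w.1 μ) : ℤ) : ℝ) + (((((ℓ + 1) ^ i.k : ℕ) : ℝ)) - 1) := fun μ => by
    have h := mul_circAbs_ediv_sub_ediv_le hb1 (UT.one_le Nb μ) (z.1 μ) (w.1 μ)
    have hN : (ℓ + 1) ^ i.k * Nb μ = Nf μ := by rw [← hNb μ, hNf μ]
    rw [hN] at h
    exact_mod_cast h
  calc ∑ μ, ((((ℓ + 1) ^ i.k : ℕ) : ℝ)) * ((circAbs (Nb μ) (z.1 μ / (((ℓ + 1) ^ i.k : ℕ) : ℤ) - w.1 μ / (((ℓ + 1) ^ i.k : ℕ) : ℤ)) : ℤ) : ℝ)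
      ≤ ∑ μ : Fin (d + 1), (((circAbs (Nf μ) (z.1 μ - w.1 μ) : ℤ) : ℝ) + (((((ℓ + 1) ^ i.k : ℕ) : ℝ)) - 1)) := Finset.sum_le_sum fun μ _ => hcoord μ
    _ = ∑ μ, ((circAbs (Nf μ) (z.1 μ - w.1 μ) : ℤ) : ℝ) + ((d : ℝ) + 1) * (((((ℓ + 1) ^ i.k : ℕ) : ℝ)) - 1) := by
        rw [Finset.sum_add_distrib, Finset.sum_const, Finset.card_univ, Fintype.card_fin, nsmul_eq_mul]; push_cast; ring

/-- ★ **FINE AGAINST BLOCK**: `d₁(ℓ_fine z, ℓ_fine w) ≤ L^k·d₁(ℓ_blk z, ℓ_blk w) + (d+1)(L^k − 1)` — §1 summed over the coordinates.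
[cite: Balaban1988RG2Cluster, (2.5) p.12, p.15; Balaban1984PropagatorsII, (2.46) p.231; Balaban1984PropagatorsI, (1.18) p.20] -/
theorem tdist1_fineReadingY_le_mul (hNf : ∀ μ, (toKT i).NB μ = Nf μ) (hNb : ∀ μ, (toKT i).NB μ = (ℓ + 1) ^ i.k * Nb μ) (z w : SiteY i) :
    tdist1 Nf (fineReadingY i hNf z) (fineReadingY i hNf w) ≤
      ((((ℓ + 1) ^ i.k : ℕ) : ℝ)) * tdist1 Nb (blockReadingY i hNb z) (blockReadingY i hNb w) + ((d : ℝ) + 1) * (((((ℓ + 1) ^ i.k : ℕ) : ℝ)) - 1) := by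
  rw [tdist1_blockReadingY_eq, tdist1_fineReadingY_eq, Finset.mul_sum]
  have hb1 : 1 ≤ (ℓ + 1) ^ i.k := Nat.one_le_pow _ _ (Nat.succ_pos ℓ)
  have hcoord : ∀ μ, ((circAbs (Nf μ) (z.1 μ - w.1 μ) : ℤ) : ℝ) ≤
      ((((ℓ + 1) ^ i.k : ℕ) : ℝ)) * ((circAbs (Nb μ) (z.1 μ / (((ℓ + 1) ^ i.k : ℕ) : ℤ) - w.1 μ / (((ℓ + 1) ^ i.k : ℕ) : ℤ)) : ℤ) : ℝ) +
        (((((ℓ + 1) ^ i.k : ℕ) : ℝ)) - 1) := fun μ => by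
    have h := circAbs_sub_le_mul_circAbs_ediv ((ℓ + 1) ^ i.k) (Nb μ) hb1 (UT.one_le Nb μ) (z.1 μ) (w.1 μ)
    have hN : (ℓ + 1) ^ i.k * Nb μ = Nf μ := by rw [← hNb μ, hNf μ]
    rw [hN] at h
    exact_mod_cast h
  calc ∑ μ, ((circAbs (Nf μ) (z.1 μ - w.1 μ) : ℤ) : ℝ)
      ≤ ∑ μ : Fin (d + 1), (((((ℓ + 1) ^ i.k : ℕ) : ℝ)) * ((circAbs (Nb μ) (z.1 μ / (((ℓ + 1) ^ i.k : ℕ) : ℤ) - w.1 μ / (((ℓ + 1) ^ i.k : ℕ) : ℤ)) : ℤ) : ℝ) +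
          (((((ℓ + 1) ^ i.k : ℕ) : ℝ)) - 1)) := Finset.sum_le_sum fun μ _ => hcoord μ
    _ = ∑ μ, ((((ℓ + 1) ^ i.k : ℕ) : ℝ)) * ((circAbs (Nb μ) (z.1 μ / (((ℓ + 1) ^ i.k : ℕ) : ℤ) - w.1 μ / (((ℓ + 1) ^ i.k : ℕ) : ℤ)) : ℤ) : ℝ) +
          ((d : ℝ) + 1) * (((((ℓ + 1) ^ i.k : ℕ) : ℝ)) - 1) := by
        rw [Finset.sum_add_distrib, Finset.sum_const, Finset.card_univ, Fintype.card_fin, nsmul_eq_mul]; push_cast; ring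

/-- **BLOCK AGAINST FINE, NORMALISED** (`κ = 1∕L^k`, `s = (d+1)(L^k−1)∕L^k`): the `hcmp` shape of `B13EntryLetterSockets.rawEntryLetters_of_reading_lipschitz`.
[cite: Balaban1988RG2Cluster, (2.5) p.12; Balaban1984PropagatorsII, (2.46) p.231] -/
theorem tdist1_blockReadingY_le_affine (hNf : ∀ μ, (toKT i).NB μ = Nf μ) (hNb : ∀ μ, (toKT i).NB μ = (ℓ + 1) ^ i.k * Nb μ) (z w : SiteY i) :
    tdist1 Nb (blockReadingY i hNb z) (blockReadingY i hNb w) ≤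
      ((((ℓ + 1) ^ i.k : ℕ) : ℝ))⁻¹ * tdist1 Nf (fineReadingY i hNf z) (fineReadingY i hNf w) +
        ((d : ℝ) + 1) * (((((ℓ + 1) ^ i.k : ℕ) : ℝ)) - 1) / ((((ℓ + 1) ^ i.k : ℕ) : ℝ)) := by
  have hb : (0 : ℝ) < ((((ℓ + 1) ^ i.k : ℕ) : ℝ)) := by positivity
  have h := mul_tdist1_blockReadingY_le i hNf hNb z w
  rw [← le_div_iff₀' hb] at h
  calc tdist1 Nb (blockReadingY i hNb z) (blockReadingY i hNb w)
      ≤ (tdist1 Nf (fineReadingY i hNf z) (fineReadingY i hNf w) + ((d : ℝ) + 1) * (((((ℓ + 1) ^ i.k : ℕ) : ℝ)) - 1)) / ((((ℓ + 1) ^ i.k : ℕ) : ℝ)) := h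
    _ = _ := by rw [add_div, div_eq_inv_mul]

end Compare

/-! ## §3. Letters transport between the two readings -/

section Transport

variable {E : Type*} [NormedAddCommGroup E] [NormedSpace ℂ E] {q : Type}
variable {Δ : E → Matrix q q ℂ} {R ρ B : ℝ}

/-- ★★ **FINE ⟹ BLOCK**: a letters datum of ANY family read at the fine reading through ANY index map `g : q → SiteY i`, rate `ρ ≥ 0` per fine site, is read
at the unit-block reading with rate `ρ·L^k` per unit block and constant `B·e^{ρ(d+1)(L^k−1)}` ([Balaban1985BackgroundPropagators] (3.42): `exp(−δ₀(Lʲη)⁻¹|x−y|)` on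
the fine lattice IS `exp(−δ₀·(unit distance))` up to the rounding; [Balaban1988RG2Cluster] (2.5): the expansion's kernels are read on `T₁^{(k)}`).
[cite: Balaban1985BackgroundPropagators, Thm 3.1 (3.42) p.397, (3.107)-(3.108) p.416; Balaban1988RG2Cluster, (2.5) p.12, p.15] -/
theorem rawEntryLetters_blockReading_of_fineReading (hNf : ∀ μ, (toKT i).NB μ = Nf μ) (hNb : ∀ μ, (toKT i).NB μ = (ℓ + 1) ^ i.k * Nb μ)
    (g : q → SiteY i) (h : RawEntryLetters Δ (fineReadingY i hNf ∘ g) R ρ B) (hρ : 0 ≤ ρ) :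
    RawEntryLetters Δ (blockReadingY i hNb ∘ g) R (ρ * ((((ℓ + 1) ^ i.k : ℕ) : ℝ)))
      (B * Real.exp (ρ * (((d : ℝ) + 1) * (((((ℓ + 1) ^ i.k : ℕ) : ℝ)) - 1)))) := by
  have hb : (0 : ℝ) < ((((ℓ + 1) ^ i.k : ℕ) : ℝ)) := by positivity
  have h' := rawEntryLetters_of_reading_lipschitz h hρ (blockReadingY i hNb ∘ g) (inv_pos.2 hb)
    (s := ((d : ℝ) + 1) * (((((ℓ + 1) ^ i.k : ℕ) : ℝ)) - 1) / ((((ℓ + 1) ^ i.k : ℕ) : ℝ)))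
    (fun a b => tdist1_blockReadingY_le_affine i hNf hNb (g a) (g b))
  refine rawEntryLetters_mono h' le_rfl (le_of_eq ?_) (le_of_eq ?_)
  · rw [div_inv_eq_mul]
  · rw [div_inv_eq_mul]
    congr 1
    field_simp

/-- ★★ **BLOCK ⟹ FINE**: a letters datum read at the unit-block reading through ANY index map `g`, rate `ρ ≥ 0` per unit block, is read at the fine reading
with rate `ρ∕L^k` per fine site and constant `B·e^{(ρ∕L^k)(d+1)(L^k−1)}`.
[cite: Balaban1985BackgroundPropagators, Thm 3.1 (3.42) p.397, (3.107)-(3.108) p.416; Balaban1988RG2Cluster, (2.5) p.12, p.15] -/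
theorem rawEntryLetters_fineReading_of_blockReading (hNf : ∀ μ, (toKT i).NB μ = Nf μ) (hNb : ∀ μ, (toKT i).NB μ = (ℓ + 1) ^ i.k * Nb μ)
    (g : q → SiteY i) (h : RawEntryLetters Δ (blockReadingY i hNb ∘ g) R ρ B) (hρ : 0 ≤ ρ) :
    RawEntryLetters Δ (fineReadingY i hNf ∘ g) R (ρ / ((((ℓ + 1) ^ i.k : ℕ) : ℝ)))
      (B * Real.exp (ρ / ((((ℓ + 1) ^ i.k : ℕ) : ℝ)) * (((d : ℝ) + 1) * (((((ℓ + 1) ^ i.k : ℕ) : ℝ)) - 1)))) :=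
  rawEntryLetters_of_reading_lipschitz h hρ (fineReadingY i hNf ∘ g) (by positivity)
    (fun a b => tdist1_fineReadingY_le_mul i hNf hNb (g a) (g b))

/-- **BLOCK ⟹ FINE, ROUNDED CONSTANT** `B·e^{ρ(d+1)}` (`(L^k − 1)∕L^k ≤ 1`). [cite: Balaban1985BackgroundPropagators, (3.107)-(3.108) p.416; Balaban1988RG2Cluster, (2.5) p.12] -/
theorem rawEntryLetters_fineReading_of_blockReading' (hNf : ∀ μ, (toKT i).NB μ = Nf μ) (hNb : ∀ μ, (toKT i).NB μ = (ℓ + 1) ^ i.k * Nb μ)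
    (g : q → SiteY i) (h : RawEntryLetters Δ (blockReadingY i hNb ∘ g) R ρ B) (hρ : 0 ≤ ρ) :
    RawEntryLetters Δ (fineReadingY i hNf ∘ g) R (ρ / ((((ℓ + 1) ^ i.k : ℕ) : ℝ))) (B * Real.exp (ρ * ((d : ℝ) + 1))) := by
  have hb1 : (1 : ℝ) ≤ ((((ℓ + 1) ^ i.k : ℕ) : ℝ)) := by exact_mod_cast Nat.one_le_pow _ _ (Nat.succ_pos ℓ)
  have hb : (0 : ℝ) < ((((ℓ + 1) ^ i.k : ℕ) : ℝ)) := by positivity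
  refine rawEntryLetters_mono (rawEntryLetters_fineReading_of_blockReading i hNf hNb g h hρ) le_rfl le_rfl ?_
  refine mul_le_mul_of_nonneg_left (Real.exp_le_exp.2 ?_) h.B_nonneg
  rw [div_mul_eq_mul_div, div_le_iff₀ hb]
  have hd : (0 : ℝ) ≤ (d : ℝ) + 1 := by positivity
  nlinarith [mul_nonneg hρ hd]

end Transport

/-! ## §4. The bond-indexed instances (`bondReadingY = ℓ_fine ∘ chart ∘ src`) -/

section Bonds

variable {E : Type*} [NormedAddCommGroup E] [NormedSpace ℂ E] {κ : Type}
variable {Δ : E → Matrix (FBondY i × κ) (FBondY i × κ) ℂ} {R ρ B : ℝ}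

/-- **BONDS, FINE ⟹ BLOCK**: letters read at dag-n10-w4's fine bond reading `bondReadingY ∘ fst` (a bond by its source) transport to the unit-block reading of the
bond's source `(ℓ_blk ∘ chart ∘ src) ∘ fst`, rate `ρ·L^k`, constant `B·e^{ρ(d+1)(L^k−1)}`. [cite: Balaban1985BackgroundPropagators, (3.3) p.391, (3.107)-(3.108) p.416; Balaban1988RG2Cluster, (2.5) p.12] -/
theorem rawEntryLetters_blockBondReading_of_bondReading (hNf : ∀ μ, (toKT i).NB μ = Nf μ) (hNb : ∀ μ, (toKT i).NB μ = (ℓ + 1) ^ i.k * Nb μ)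
    (h : RawEntryLetters Δ (fun p : FBondY i × κ => bondReadingY i hNf p.1) R ρ B) (hρ : 0 ≤ ρ) :
    RawEntryLetters Δ (fun p : FBondY i × κ => blockReadingY i hNb (boxEquiv i.hN p.1.src)) R (ρ * ((((ℓ + 1) ^ i.k : ℕ) : ℝ)))
      (B * Real.exp (ρ * (((d : ℝ) + 1) * (((((ℓ + 1) ^ i.k : ℕ) : ℝ)) - 1)))) :=
  rawEntryLetters_blockReading_of_fineReading i hNf hNb (fun p : FBondY i × κ => boxEquiv i.hN p.1.src) h hρ

/-- **BONDS, BLOCK ⟹ FINE**: the converse, rate `ρ∕L^k`, constant `B·e^{(ρ∕L^k)(d+1)(L^k−1)}`.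
[cite: Balaban1985BackgroundPropagators, (3.3) p.391, (3.107)-(3.108) p.416; Balaban1988RG2Cluster, (2.5) p.12] -/
theorem rawEntryLetters_bondReading_of_blockBondReading (hNf : ∀ μ, (toKT i).NB μ = Nf μ) (hNb : ∀ μ, (toKT i).NB μ = (ℓ + 1) ^ i.k * Nb μ)
    (h : RawEntryLetters Δ (fun p : FBondY i × κ => blockReadingY i hNb (boxEquiv i.hN p.1.src)) R ρ B) (hρ : 0 ≤ ρ) :
    RawEntryLetters Δ (fun p : FBondY i × κ => bondReadingY i hNf p.1) R (ρ / ((((ℓ + 1) ^ i.k : ℕ) : ℝ)))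
      (B * Real.exp (ρ / ((((ℓ + 1) ^ i.k : ℕ) : ℝ)) * (((d : ℝ) + 1) * (((((ℓ + 1) ^ i.k : ℕ) : ℝ)) - 1)))) :=
  rawEntryLetters_fineReading_of_blockReading i hNf hNb (fun p : FBondY i × κ => boxEquiv i.hN p.1.src) h hρ

end Bonds

end Literature.MathematicalPhysics.QuantumFieldTheory.Balaban1983to89.B13ReadingTransportY
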